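import Literature.Geometry.Lorentzian.VacuumLocalLimitExhaustion
import Literature.Geometry.Lorentzian.TimeTranslateOmegaLimit
import Literature.Geometry.Lorentzian.SpacetimeLocalConvergenceSubseq
import HarnessLib

/-!
# ω-limits of a future chart along times `tₙ → ∞` exist and are eternal

`TimeTranslateOmegaLimit.lean` produces ω-limits along time translations of an ETERNAL tame chart.
Charts of a Cauchy development are only defined to the future of the data: this file treats a chart
`Φ : B.domain → 𝓢` on a time-translation-invariant domain which is smooth, injective, `C⁰`-pinched
and `Cᵏ`-bounded (every `k`) only on its LATE PIECE `{x ∈ B.domain | t₀ < x⁰}`. Along any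
`tₙ → +∞` the translates `Φ(· + tₙ ∂₀)` are good on the pieces `{x⁰ > t₀ − tₙ}`, which exhaust the
eternal domain, so the producer on an exhaustion (`TameChartCompactnessExhaustion.lean`) applies after
passing to a subsequence with `tₙ` increasing fast:

**Theorem (`Spacetime.exists_omegaLimit_timeTranslates_of_lateChart`).** For every `x₀ ∈ B.domain`
and `tₙ → +∞`, `(𝓢, Φ(x₀ + tₙ ∂₀))` subconverges in the pointed `Cᵏ_loc` sense WITH FAR CHARTS
`Φ(· + tₙ ∂₀) → id` (`SubconvergesLocallyWithFarChartsTo`, the `ArisesFrom` notion), for every `k`, to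
the near-Minkowski chart spacetime of a smooth limit field `G` on the WHOLE (eternal) domain, with
`‖G − η‖ ≤ θ` and `supCkENorm B.domain k (G − η) ≤ Λ_k`, Ricci-flat if `𝓢` is — an ETERNAL uniformly tame
(vacuum) limit of a future development ("late-time limits are eternal": cut (d) of the ω-limit stubs of the tame
final-state routes for the far zone `Kerr.region 0 R`).

## References
* P. Petersen, *Riemannian Geometry*, 2nd ed., GTM 171, Springer 2006, Ch. 10, §3.2. [Petersen2006]
* M. T. Anderson, Cheeger–Gromov theory and applications to general relativity, 2004, §5. [Anderson2004]
-/

noncomputable section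

open Set Metric Filter Topology Function TopologicalSpace
open scoped Manifold ContDiff Topology ENNReal

universe u

set_option maxSynthPendingDepth 3

namespace Literature.Geometry.Lorentzian

namespace ModelBackground

variable (B : ModelBackground)
  (hT : ∀ (s : ℝ), ∀ x ∈ (B.domain : Set E4), x + s • E4.basisVector 0 ∈ (B.domain : Set E4))

/-- The **late piece** `{x ∈ B.domain | c < x⁰}` of the domain, as an open subset of `E4`. [folklore] -/
def latePiece (c : ℝ) : Opens E4 :=
  ⟨{x | x ∈ (B.domain : Set E4) ∧ c < x 0},
    B.domain.2.inter (isOpen_lt continuous_const (EuclideanSpace.proj (0 : Fin 4)).continuous)⟩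

/-- Membership in the late piece. [folklore] -/
@[simp]
theorem mem_latePiece {c : ℝ} {x : E4} : x ∈ B.latePiece c ↔ x ∈ (B.domain : Set E4) ∧ c < x 0 :=
  Iff.rfl

/-- Late pieces lie in the domain. [folklore] -/
theorem latePiece_subset (c : ℝ) : (B.latePiece c : Set E4) ⊆ (B.domain : Set E4) := fun _ hx ↦ hx.1

/-- Late pieces decrease in `c`. [folklore] -/
theorem latePiece_mono {c c' : ℝ} (h : c' ≤ c) : B.latePiece c ≤ B.latePiece c' :=
  fun _ hx ↦ ⟨hx.1, h.trans_lt hx.2⟩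

/-- The time translation by `s` maps the late piece after `c` into the late piece after `c + s`.
[folklore] -/
theorem timeShift_mem_latePiece {c s : ℝ} {x : B.domain} (hx : (x : E4) ∈ B.latePiece c) :
    ((B.timeShift hT s x : B.domain) : E4) ∈ B.latePiece (c + s) := by
  refine ⟨(B.timeShift hT s x).2, ?_⟩
  show c + s < (x.1 + s • E4.basisVector 0) 0
  have h2 : (x.1 + s • E4.basisVector 0) 0 = x.1 0 + s := by
    simp [E4.basisVector]
  rw [h2]
  linarith [hx.2]

/-- The inverse time translation undoes the time translation. [folklore] -/
theorem timeShift_neg_timeShift (s : ℝ) (x : B.domain) :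
    B.timeShift hT (-s) (B.timeShift hT s x) = x := by
  apply Subtype.ext
  show x.1 + s • E4.basisVector 0 + (-s) • E4.basisVector 0 = x.1
  rw [add_assoc, ← add_smul, add_neg_cancel, zero_smul, add_zero]

end ModelBackground

namespace Spacetime

variable (𝓢 : Spacetime.{u} 4) (B : ModelBackground)
  (hT : ∀ (s : ℝ), ∀ x ∈ (B.domain : Set E4), x + s • E4.basisVector 0 ∈ (B.domain : Set E4))
  (Φ : B.domain → 𝓢.carrier)

/-- Differentiability of `Φ ∘ T_s` at `x` is differentiability of `Φ` at `T_s x`. [folklore] -/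
theorem mdifferentiableAt_comp_timeShift_iff (s : ℝ) (x : B.domain) :
    MDifferentiableAt 𝓘(ℝ, E4) (𝓡 4) (Φ ∘ B.timeShift hT s) x ↔
      MDifferentiableAt 𝓘(ℝ, E4) (𝓡 4) Φ (B.timeShift hT s x) := by
  constructor
  · intro h
    have hx' : B.timeShift hT (-s) (B.timeShift hT s x) = x := B.timeShift_neg_timeShift hT s x
    have h0 : MDifferentiableAt 𝓘(ℝ, E4) (𝓡 4) (Φ ∘ B.timeShift hT s)
        (B.timeShift hT (-s) (B.timeShift hT s x)) := by rw [hx']; exact h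
    have h' := h0.comp (B.timeShift hT s x)
      (((B.contMDiff_timeShift hT (-s)) _).mdifferentiableAt (by simp))
    have heq : (Φ ∘ B.timeShift hT s) ∘ B.timeShift hT (-s) = Φ := by
      funext y
      show Φ (B.timeShift hT s (B.timeShift hT (-s) y)) = Φ y
      have := B.timeShift_neg_timeShift hT (-s) y
      rw [neg_neg] at this
      rw [this]
    rw [heq] at h'
    exact h'
  · intro h
    exact h.comp x (((B.contMDiff_timeShift hT s) _).mdifferentiableAt (by simp))

/-- **The deviation of a translated chart is the translate of the deviation — at every point**
(differentiable or not: at non-differentiable points both differentials are Mathlib's zero).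
[folklore] -/
theorem deviation_comp_timeShift' (hbil : ∀ (s : ℝ), ∀ y ∈ (B.domain : Set E4),
    B.bilin (y + s • E4.basisVector 0) = B.bilin y) (s : ℝ) (x : B.domain) :
    𝓢.deviation B (Φ ∘ B.timeShift hT s) x = 𝓢.deviation B Φ (B.timeShift hT s x) := by
  ext v w
  rw [Spacetime.deviation_apply, Spacetime.deviation_apply, B.timeShift_coe, hbil s x.1 x.2]
  by_cases hd : MDifferentiableAt 𝓘(ℝ, E4) (𝓡 4) Φ (B.timeShift hT s x)
  · have hc : ∀ u : E4, mfderiv 𝓘(ℝ, E4) (𝓡 4) (Φ ∘ B.timeShift hT s) x u =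
        mfderiv 𝓘(ℝ, E4) (𝓡 4) Φ (B.timeShift hT s x) u := fun u ↦
      (DFunLike.congr_fun (mfderiv_comp x hd
        (((B.contMDiff_timeShift hT s) _).mdifferentiableAt (by simp))) u).trans
        (congrArg (mfderiv 𝓘(ℝ, E4) (𝓡 4) Φ (B.timeShift hT s x)) (B.mfderiv_timeShift_apply hT s x u))
    rw [hc v, hc w]
    rfl
  · have hd' : ¬ MDifferentiableAt 𝓘(ℝ, E4) (𝓡 4) (Φ ∘ B.timeShift hT s) x :=
      fun h ↦ hd ((𝓢.mdifferentiableAt_comp_timeShift_iff B hT Φ s x).1 h)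
    rw [mfderiv_zero_of_not_mdifferentiableAt hd', mfderiv_zero_of_not_mdifferentiableAt hd]
    rfl

/-- The zero-extended deviations: `deviationExtend B (Φ ∘ T_s) = deviationExtend B Φ ∘ (· + s ∂₀)`,
no smoothness assumed. [folklore] -/
theorem deviationExtend_comp_timeShift' (hbil : ∀ (s : ℝ), ∀ y ∈ (B.domain : Set E4),
    B.bilin (y + s • E4.basisVector 0) = B.bilin y) (s : ℝ) :
    𝓢.deviationExtend B (Φ ∘ B.timeShift hT s) =
      fun y ↦ 𝓢.deviationExtend B Φ (y + s • E4.basisVector 0) := by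
  funext y
  by_cases hy : y ∈ (B.domain : Set E4)
  · exact (𝓢.deviationExtend_coe B (Φ ∘ B.timeShift hT s) ⟨y, hy⟩).trans
      ((𝓢.deviation_comp_timeShift' B hT Φ hbil s ⟨y, hy⟩).trans
        (𝓢.deviationExtend_coe B Φ (B.timeShift hT s ⟨y, hy⟩)).symm)
  · have hy' : y + s • E4.basisVector 0 ∉ (B.domain : Set E4) := fun h ↦ by
      have := hT (-s) _ h
      rw [add_assoc, ← add_smul, add_neg_cancel, zero_smul, add_zero] at this
      exact hy this
    rw [𝓢.deviationExtend_of_not_mem B _ hy, 𝓢.deviationExtend_of_not_mem B _ hy']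

/-- **`Cᵏ` sup norms of the translated chart over a set are bounded by those of the chart over the
translated set.** [folklore] -/
theorem supCkENorm_deviationExtend_comp_timeShift_le (hbil : ∀ (s : ℝ), ∀ y ∈ (B.domain : Set E4),
    B.bilin (y + s • E4.basisVector 0) = B.bilin y) (s : ℝ) (k : ℕ) {S S' : Set E4}
    (hSS' : ∀ y ∈ S, y + s • E4.basisVector 0 ∈ S') :
    supCkENorm S k (𝓢.deviationExtend B (Φ ∘ B.timeShift hT s)) ≤
      supCkENorm S' k (𝓢.deviationExtend B Φ) := by
  rw [𝓢.deviationExtend_comp_timeShift' B hT Φ hbil s]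
  refine supCkENorm_le_of_forall_le fun m hm y hy ↦ ?_
  rw [iteratedFDeriv_comp_add_right]
  exact enorm_iteratedFDeriv_le_supCkENorm hm (hSS' y hy) _

/-- **ω-limits of a future chart along `tₙ → ∞` exist and are eternal** (module docstring).
Hypotheses on `Φ` only on the late piece `{t₀ < x⁰}`; `Φ` pushes `∂₀` to the future at one late
point; the late pieces of the domain are preconnected. [cite: Petersen2006, Ch. 10 §3.2] -/
theorem exists_omegaLimit_timeTranslates_of_lateChart (hconn : IsConnected (B.domain : Set E4))
    (hpc : ∀ c : ℝ, IsPreconnected (B.latePiece c : Set E4)) {t₀ : ℝ}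
    (hΦ : ContMDiffOn 𝓘(ℝ, E4) (𝓡 4) ∞ Φ (Subtype.val ⁻¹' (B.latePiece t₀ : Set E4)))
    (hinj : InjOn Φ (Subtype.val ⁻¹' (B.latePiece t₀ : Set E4)))
    {x₁ : B.domain} (hx₁ : (x₁ : E4) ∈ B.latePiece t₀)
    (hfut : 𝓢.timeOrientation.IsFutureDirected
      (mfderiv 𝓘(ℝ, E4) (𝓡 4) Φ x₁ (E4.basisVector 0)))
    {θ : ℝ} (hθ : θ < 1)
    (hpinch : ∀ y ∈ (B.latePiece t₀ : Set E4),
      ‖𝓢.deviationExtend (Minkowski.backgroundOn B.domain) Φ y‖ ≤ θ)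
    (hbound : ∀ k : ℕ, ∃ Λ : ℝ≥0∞, Λ ≠ ⊤ ∧
      supCkENorm (B.latePiece t₀ : Set E4) k (𝓢.deviationExtend (Minkowski.backgroundOn B.domain) Φ) ≤ Λ)
    {x₀ : E4} (hx₀ : x₀ ∈ (B.domain : Set E4)) {t : ℕ → ℝ} (ht : Tendsto t atTop atTop) :
    ∃ (L : NearMinkowskiChart B.domain) (φ : ℕ → ℕ), StrictMono φ ∧
      (∀ y ∈ (B.domain : Set E4), ‖L.G y - Minkowski.bilin‖ ≤ θ) ∧
      (∀ (k : ℕ) (C : ℝ≥0∞),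
        supCkENorm (B.latePiece t₀ : Set E4) k
            (𝓢.deviationExtend (Minkowski.backgroundOn B.domain) Φ) ≤ C →
          supCkENorm (B.domain : Set E4) k (L.G - fun _ ↦ Minkowski.bilin) ≤ C) ∧
      (∀ (k : ℕ), ∀ K ⊆ (B.domain : Set E4), IsCompact K →
        Tendsto (fun j ↦ supCkENorm K k
          (𝓢.deviationExtend (Minkowski.backgroundOn B.domain) (Φ ∘ B.timeShift hT (t (φ j))) -
            (L.G - fun _ ↦ Minkowski.bilin))) atTop (𝓝 0)) ∧
      (∀ k : ℕ, SubconvergesLocallyWithFarChartsTo (fun _ ↦ 𝓢)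
        (fun n ↦ Φ (B.timeShift hT (t n) ⟨x₀, hx₀⟩)) (L.spacetime hconn) ⟨x₀, hx₀⟩ k B
        (fun n ↦ Φ ∘ B.timeShift hT (t n)) (id : B.domain → (L.spacetime hconn).carrier)) ∧
      ((∀ [𝓢.metric.toPseudoRiemannianMetric.HasLeviCivita],
          𝓢.metric.toPseudoRiemannianMetric.IsRicciFlat) →
        ∀ [(L.spacetime hconn).metric.toPseudoRiemannianMetric.HasLeviCivita],
          (L.spacetime hconn).metric.toPseudoRiemannianMetric.IsRicciFlat) := by
  -- the Minkowski form is constant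
  have hbil : ∀ (s : ℝ), ∀ y ∈ ((Minkowski.backgroundOn B.domain).domain : Set E4),
      (Minkowski.backgroundOn B.domain).bilin (y + s • E4.basisVector 0) =
        (Minkowski.backgroundOn B.domain).bilin y := fun _ _ _ ↦ rfl
  -- pass to a subsequence with `t (ρ n) ≥ t₀ − x₀⁰ + n + 1`
  obtain ⟨ρ, hρ, hρt⟩ : ∃ ρ : ℕ → ℕ, StrictMono ρ ∧ ∀ n : ℕ, t₀ - x₀ 0 + (n + 1) ≤ t (ρ n) :=
    extraction_forall_of_eventually' (P := fun (n m : ℕ) ↦ t₀ - x₀ 0 + (n + 1) ≤ t m) fun n ↦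
      eventually_atTop.1 (ht.eventually_ge_atTop (t₀ - x₀ 0 + (n + 1)))
  -- the pieces `W n = {x⁰ > x₀⁰ − (n+1)}` and the translated charts
  let W : ℕ → Opens E4 := fun n ↦ B.latePiece (x₀ 0 - (n + 1))
  let Ψ : ∀ n : ℕ, B.domain → 𝓢.carrier := fun n ↦ Φ ∘ B.timeShift hT (t (ρ n))
  have hWm : Monotone W := fun n n' h ↦ B.latePiece_mono (by
    have : (n : ℝ) ≤ n' := by exact_mod_cast h
    linarith)
  have hWU : ∀ y ∈ (B.domain : Set E4), ∃ n, y ∈ (W n : Set E4) := fun y hy ↦ by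
    obtain ⟨n, hn⟩ := exists_nat_gt (x₀ 0 - y 0)
    exact ⟨n, hy, by linarith⟩
  have hW0 : x₀ ∈ (W 0 : Set E4) := ⟨hx₀, by norm_num⟩
  -- translates of the pieces are late
  have hlate : ∀ n, ∀ y ∈ (W n : Set E4), y + t (ρ n) • E4.basisVector 0 ∈ (B.latePiece t₀ : Set E4) := by
    intro n y hy
    have h := B.timeShift_mem_latePiece hT (s := t (ρ n)) (x := ⟨y, hy.1⟩) hy
    refine B.latePiece_mono ?_ h
    have := hρt n
    linarith
  have hmaps : ∀ n, MapsTo (B.timeShift hT (t (ρ n))) (Subtype.val ⁻¹' (W n : Set E4))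
      (Subtype.val ⁻¹' (B.latePiece t₀ : Set E4)) := fun n x hx ↦ hlate n x.1 hx
  have hΨs : ∀ n, ContMDiffOn 𝓘(ℝ, E4) (𝓡 4) ∞ (Ψ n) (Subtype.val ⁻¹' (W n : Set E4)) := fun n ↦
    hΦ.comp (B.contMDiff_timeShift hT (t (ρ n))).contMDiffOn (hmaps n)
  have hΨi : ∀ n, InjOn (Ψ n) (Subtype.val ⁻¹' (W n : Set E4)) := fun n ↦
    hinj.comp (B.injective_timeShift hT (t (ρ n))).injOn (hmaps n)
  have hpinch' : ∀ n, ∀ y ∈ (W n : Set E4),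
      ‖𝓢.deviationExtend (Minkowski.backgroundOn B.domain) (Ψ n) y‖ ≤ θ := by
    intro n y hy
    have h := congrFun (𝓢.deviationExtend_comp_timeShift' (Minkowski.backgroundOn B.domain) hT Φ hbil
      (t (ρ n))) y
    rw [show 𝓢.deviationExtend (Minkowski.backgroundOn B.domain) (Ψ n) y =
      𝓢.deviationExtend (Minkowski.backgroundOn B.domain) Φ (y + t (ρ n) • E4.basisVector 0) from h]
    exact hpinch _ (hlate n y hy)
  have hbound' : ∀ k : ℕ, ∃ Λ : ℝ≥0∞, Λ ≠ ⊤ ∧ ∀ n, supCkENorm (W n : Set E4) k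
      (𝓢.deviationExtend (Minkowski.backgroundOn B.domain) (Ψ n)) ≤ Λ := fun k ↦
    (hbound k).imp fun Λ hΛ ↦ ⟨hΛ.1, fun n ↦
      (𝓢.supCkENorm_deviationExtend_comp_timeShift_le (Minkowski.backgroundOn B.domain) hT Φ hbil
        (t (ρ n)) k (hlate n)).trans hΛ.2⟩
  -- orientation at the centre of each translate: from the one late point, on the preconnected late piece
  have hfut' : ∀ n, 𝓢.timeOrientation.IsFutureDirected
      (mfderiv 𝓘(ℝ, E4) (𝓡 4) (Ψ n) ⟨x₀, hx₀⟩ (E4.basisVector 0)) := by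
    intro n
    have hx₀W : x₀ + t (ρ n) • E4.basisVector 0 ∈ (B.latePiece t₀ : Set E4) :=
      hlate n x₀ (hWm (Nat.zero_le n) hW0)
    have hd : MDifferentiableAt 𝓘(ℝ, E4) (𝓡 4) Φ (B.timeShift hT (t (ρ n)) ⟨x₀, hx₀⟩) :=
      𝓢.mdifferentiableAt_of_contMDiffOn_preimage B Φ (B.latePiece t₀).2 hΦ _ hx₀W
    have hc : mfderiv 𝓘(ℝ, E4) (𝓡 4) (Ψ n) ⟨x₀, hx₀⟩ (E4.basisVector 0) =
        mfderiv 𝓘(ℝ, E4) (𝓡 4) Φ (B.timeShift hT (t (ρ n)) ⟨x₀, hx₀⟩) (E4.basisVector 0) :=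
      (DFunLike.congr_fun (mfderiv_comp _ hd
        (((B.contMDiff_timeShift hT _) _).mdifferentiableAt (by simp))) _).trans
        (congrArg (mfderiv 𝓘(ℝ, E4) (𝓡 4) Φ _) (B.mfderiv_timeShift_apply hT _ _ _))
    rw [hc]
    exact 𝓢.isFutureDirected_mfderiv_basisVector_zero_of_isPreconnected_of_contMDiffOn Φ
      (B.latePiece t₀).2 (B.latePiece_subset t₀) hΦ (fun y hy ↦ (hpinch y hy).trans_lt hθ) (hpc t₀)
      subset_rfl hx₁ hfut _ hx₀W
  obtain ⟨L, φ, hφ, h1, h2, h3, h4, h5⟩ :=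
    exists_nearMinkowskiChart_subconvergesLocallyWithFarChartsTo_of_exhaustion_vacuum
      (𝓢ₙ := fun _ ↦ 𝓢) (pₙ := fun n ↦ Φ (B.timeShift hT (t (ρ n)) ⟨x₀, hx₀⟩)) B hconn hx₀ W
      (fun n ↦ B.latePiece_subset _) hWm (fun n ↦ hpc _) hW0 hWU Ψ hΨs hΨi (fun _ ↦ rfl) hfut' hθ
      hpinch' hbound'
  refine ⟨L, ρ ∘ φ, hρ.comp hφ, h1, fun k C hC ↦ h2 k C fun n ↦ ?_, h3, fun k ↦
    SubconvergesLocallyWithFarChartsTo.ofSubseq (Φₙ := fun n ↦ Φ ∘ B.timeShift hT (t n)) hρ (h4 k),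
    fun hvac ↦ h5 fun _ ↦ hvac⟩
  exact (𝓢.supCkENorm_deviationExtend_comp_timeShift_le (Minkowski.backgroundOn B.domain) hT Φ hbil
    (t (ρ n)) k (hlate n)).trans hC

end Spacetime

end Literature.Geometry.Lorentzian

end
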